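import Summits.ABC.IUTFork.Joshi.ATS4MainBounds
import Summits.ABC.IUTFork.Joshi.ATS4Differents
import Summits.ABC.IUTFork.Joshi.ATS4RamificationTateDivisor
import Summits.ABC.IUTFork.Joshi.ATS4EasyLemmata
import Summits.ABC.IUTFork.Joshi.ATS4DescentToFirstMainBound
import Literature.IUT.LogVolume.DifferentConductorTowerThreeField
import HarnessLib

/-!
# Joshi, *Arithmetic Teichmüller spaces IV* [J-IV] §6.1/§6.4 on GENUINE number-field towers: `MainBoundDatum.ofGenuine`,
# and Lemmas 6.4.1 / 6.4.2 (1)(2) + the second inequality of Theorem 6.1.1 PROVED there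

Proof-and-dictionary companion of `Joshi/ATS4MainBounds.lean` (slot T-30 of plan/E/ASSIGNMENTS.md; abc-iut cell, block E,
rung LADDER-ABC:A2.E; merge-debt of record plan/E/t30/INVENTORY.tsv row J4:Thm6.1.1.hyp «T-26's genuine number fields
instantiate this datum»). TAKES NO SIDE on [IUTchIII] Cor. 3.12, on Joshi's claims, or on Mochizuki's reports on them; the
source is an unrefereed arXiv preprint (arXiv:2403.10430v2, bib `Joshi2024ATS4`); typed ≠ proved ≠ endorsed.

## What is here

1. `MainBoundDatum.ofGenuine` — OUR READING of the numbers Theorem 6.1.1 (p.58 l.1–23) speaks about, over genuine Mathlib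
   number fields `L_mod`, `L_tpd → L → L′` with T-26's Tate-divisor data (`TateDivisorDatum`, [J-IV] Def. 4.4.2):
   `d_mod := [L_mod : ℚ]` (`dMod`), `e_mod := max_v e_v` (`eMod`; «e_mod ≤ d_mod» is T-26's PROVED `eMod_le_dMod`),
   `log(q) := log(𝔮_L)` («q = q_{C/L} the Tate divisor of C/L», p.58 l.4), `log(d^M) := logDifferent M` (§4.3),
   `log(f^M) := log(𝔣_M)` (`TateDivisorDatum.logf`), `[L : L_tpd]`, `[L′ : L]` := `Module.finrank`. Dictionary only.
2. PROVED for that datum (hypotheses = the printed inputs, in the kernel vocabulary of the tree's [IUTchIV] Thm. 1.10 Step (ii)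
   engine `Literature.IUT.LogVolume.ndeg_different_add_reduced_le_F/_K`):
   * Thm. 4.6.1 (2) for `L/L_tpd` = T-30's `DiffCondMono` = **the second inequality of Thm. 6.1.1** (`ofGenuine_diffCondMono`,
     `ofGenuine_boundLtpd_le_boundL`), from support compatibility alone; hence `Thm611 ↔ its first inequality`
     (`ofGenuine_thm611_iff`).
   * **Lemma 6.4.1** (p.59 l.25–27, «+33») for `L/L_tpd` Galois with `[L : L_tpd] ∣ 2¹⁰·3²·5` (p.59 l.31), unramified resp. tamely
     ramified over the primes of residue characteristic `∤ 2·3·5` off resp. on `Supp(𝔮)`: in fact with Mochizuki's constant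
     `log(2¹¹·3³·5²) ≤ 21 ≤ 33` (`ofGenuine_sharp641`, `ofGenuine_lem641`).
   * **Lemma 6.4.2 (1), (2)** (p.59 l.37–p.60 l.21, «+4·log ℓ + 33», «+4·log ℓ + 74») for, in addition, `L′/L` Galois with
     `[L′ : L] ∣ ℓ(ℓ−1)²(ℓ+1)` (= `|GL₂(𝔽_ℓ)|`, Lem. 6.3.2; the tree's division-field shape `finrank_dvd_of_ker_le`), unramified resp. tame over residue characteristic `≠ ℓ`: in fact with
     `2·log ℓ + 21` (`ofGenuine_sharp642`, `ofGenuine_lem642a`, `ofGenuine_lem642b`); and `[L′ : L] ≤ ℓ⁴`, `[L : L_tpd] ≤ 2¹⁰·3²·5`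
     (`ofGenuine_degLpLBound`, `ofGenuine_degLLtpdBound`).
3. At the abstract level: Mochizuki's Step (ii) inputs (`Thm110Numerics.ProofData.F_le`, `.K_le`, through T-30's dictionary
   `toThm110` of Rmk. 6.1.2) imply Joshi's Lem. 6.4.1 / 6.4.2 (1) (`lem641_of_sharp`, `lem642a_of_sharp`, `lem641_of_proofData`).
4. The junction with E-t31's E5 descent spine (`MainBoundGlue.thm611_left_of_inputs`, `Joshi/ATS4DescentToFirstMainBound.lean`):
   its three §6.4 inputs `Lem641`, `WildBoundLp`, `DegLpLBound` enter only through Lem. 6.4.2 (2), so they are replaced by the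
   single hypothesis `Lem642b` (`thm611_left_of_lem642b`) — PROVED above on genuine towers (`ofGenuine_thm611_left_of_descent`).

## What is NOT here (located, not adjudicated)

Joshi's own inputs `WildBoundL` / `WildBoundLp` (his Thm. 4.6.1 (5) with the factor `#S^ℚ_wild` and no additive term, T-27's
`WildBound`) are neither used nor derived: the kernel route is the tree's Galois form of [IUTchIV] Step (ii) (constants
`log(2¹¹·3³·5²)`, `2·log ℓ`), which implies Joshi's printed constants `33`, `4·log ℓ`, `74` a fortiori. The ramification
hypotheses are stated as the engine needs them («unramified off `Supp(𝔮)` ∪ {wild characteristics}»); Joshi's Lemma 4.1.4 as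
printed is weaker there (it allows tame ramification of `L/L_tpd` over `ℓ` and of `L′/L` over `2` off `Supp(𝔮)`) and is not
consumed. No elliptic curve is an object of this file; nothing of [IUTchIII] is imported (R14). Theorems + one dictionary `def`;
standard axioms; no `sorry`, instance, notation or new `Prop` fact.
-/

noncomputable section

open NumberField IsDedekindDomain Literature.IUT.LogVolume

namespace Summit.ABC.IUTFork.Joshi.ATS4

/-! ## 0. Two small facts about T-26's constants -/
section Glue

variable (M : Type*) [Field M] [NumberField M]

/-- `e_mod ≥ 1`: the ring of integers of a number field has a nonzero prime `v`, and `1 ≤ e_v ≤ e_mod`. [folklore] -/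
theorem one_le_eMod : 1 ≤ eMod M := by
  obtain ⟨p, hp0, hp⟩ := (Ring.not_isField_iff_exists_prime).mp (RingOfIntegers.not_isField M)
  let v : HeightOneSpectrum (𝓞 M) := ⟨p, hp, hp0⟩
  exact (Nat.one_le_iff_ne_zero.mpr (ramIdx_ne_zero M v)).trans (ramIdx_le_eMod v)

/-- `log(d^M) ≥ 0`: the different divisor is effective. [folklore] -/
theorem logDifferent_nonneg : 0 ≤ logDifferent M := ndeg_nonneg M (differentDivisor_isEffective M)

end Glue

namespace MainBoundDatum

/-! ## 1. Mochizuki's Step (ii) constants imply Joshi's §6.4 constants (abstract datum) -/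
section Abstract
variable (D : MainBoundDatum)

/-- `log(2¹¹·3³·5²) ≤ 21 ≤ 33`: a bound of the shape of [IUTchIV] Step (ii), second display, implies **Lemma 6.4.1** (p.59
l.25–27). [claim: Joshi2024ATS4, status: disputed] -/
theorem lem641_of_sharp (h : D.logDiffL + D.logCondL ≤ D.logDiffLtpd + D.logCondLtpd + Real.log (2 ^ 11 * 3 ^ 3 * 5 ^ 2)) :
    D.Lem641 := by
  unfold Lem641
  have h21 := log_two_pow_eleven_mul_le
  linarith

/-- `2·log ℓ ≤ 4·log ℓ`: Lemma 6.4.1 and a bound of the shape of [IUTchIV] Step (ii), third display, for `L′/L` imply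
**Lemma 6.4.2 (1)** (p.59 l.37–p.60 l.5). [claim: Joshi2024ATS4, status: disputed] -/
theorem lem642a_of_sharp (h641 : D.Lem641)
    (h : D.logDiffLp + D.logCondLp ≤ D.logDiffL + D.logCondL + 2 * Real.log D.ell) : D.Lem642a := by
  unfold Lem642a
  unfold Lem641 at h641
  have hlog : 0 ≤ Real.log (D.ell : ℝ) := Real.log_nonneg (by linarith [D.five_le_ell_real])
  refine ⟨by linarith [D.logCondLp_nonneg], ?_⟩
  linarith

/-- **Lemma 6.4.1 from the tree's typed [IUTchIV] Thm. 1.10 Step (ii) input `F_le`** through the dictionary of Rmk. 6.1.2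
(`toThm110`, any value of its `−|log(Θ)|` slot). [claim: Joshi2024ATS4, status: disputed] -/
theorem lem641_of_proofData (θ : ℝ) (P : (D.toThm110 θ).ProofData) : D.Lem641 :=
  D.lem641_of_sharp P.F_le

/-- **Lemma 6.4.2 (1) from the Step (ii) inputs `F_le`, `K_le`**, once the proof datum's `log(𝔡^K) + log(𝔣^K)` is read as
`log(d^{L′}) + log(f^{L′})` (Joshi's `L′` ↦ Mochizuki's `K`). [claim: Joshi2024ATS4, status: disputed] -/
theorem lem642a_of_proofData (θ : ℝ) (P : (D.toThm110 θ).ProofData)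
    (hK : P.logDiffK + P.logCondK = D.logDiffLp + D.logCondLp) : D.Lem642a :=
  D.lem642a_of_sharp (D.lem641_of_proofData θ P) (by have h := P.K_le; rw [hK] at h; exact h)

end Abstract

/-! ## 2. The genuine instantiation -/
section Genuine
variable (Lmod : Type*) [Field Lmod] [NumberField Lmod]
variable {Ltpd L L' : Type*} [Field Ltpd] [NumberField Ltpd] [Field L] [NumberField L] [Field L'] [NumberField L']
  [Algebra Ltpd L] [Algebra L L']
variable {ℓ : ℕ} (hℓ : ℓ.Prime) (h5 : 5 ≤ ℓ)
variable (𝔮tpd : TateDivisorDatum Ltpd) (𝔮L : TateDivisorDatum L) (𝔮L' : TateDivisorDatum L') (hq : 0 < 𝔮L.logq)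

/-- **The numbers of Theorem 6.1.1 over genuine number fields** (OUR READING of p.58 l.1–23 with §4.1.1 (2)–(5) p.37 l.36–p.38
l.3, §4.3 (4.3.1)–(4.3.2) p.39 l.41–53, Def. 4.4.2 p.40 l.48–p.41 l.14, p.59 l.31, p.60 l.26): `ℓ`; `d_mod = [L_mod : ℚ]`,
`e_mod = max_v e_v` of a number field `L_mod` (it enters Thm. 6.1.1 only through these two integers); `log(q) = log(𝔮_L)` of
the Tate-divisor datum of `C/L`, assumed `> 0` («V^{odd,ss} ≠ ∅», p.57 l.21–22); `log(d^M) = logDifferent M` and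
`log(f^M) = log(𝔣_M)` for `M = L_tpd, L, L′`; `[L : L_tpd]`, `[L′ : L]`. DICTIONARY (data only, nothing asserted).
[claim: Joshi2024ATS4, status: disputed] -/
def ofGenuine : MainBoundDatum where
  ell := ℓ
  ell_prime := hℓ
  five_le_ell := h5
  dmod := dMod Lmod
  one_le_dmod := Module.finrank_pos
  emod := eMod Lmod
  one_le_emod := one_le_eMod Lmod
  emod_le_dmod := eMod_le_dMod
  logq := 𝔮L.logq
  logq_pos := hq
  logDiffLtpd := logDifferent Ltpd
  logDiffLtpd_nonneg := logDifferent_nonneg Ltpd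
  logCondLtpd := 𝔮tpd.logf
  logCondLtpd_nonneg := 𝔮tpd.logf_nonneg
  logDiffL := logDifferent L
  logDiffL_nonneg := logDifferent_nonneg L
  logCondL := 𝔮L.logf
  logCondL_nonneg := 𝔮L.logf_nonneg
  logDiffLp := logDifferent L'
  logDiffLp_nonneg := logDifferent_nonneg L'
  logCondLp := 𝔮L'.logf
  logCondLp_nonneg := 𝔮L'.logf_nonneg
  degLLtpd := Module.finrank Ltpd L
  one_le_degLLtpd := Module.finrank_pos
  degLpL := Module.finrank L L'
  one_le_degLpL := Module.finrank_pos

/-! ### 2a. Thm. 4.6.1 (2) for `L/L_tpd` — the second inequality of Thm. 6.1.1 — from support compatibility -/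

/-- **`DiffCondMono` («log(d^{L_tpd}) + log(f^{L_tpd}) ≤ log(d^L) + log(f^L)», Thm. 4.6.1 (2) p.46 l.36–37) holds for the
genuine datum** as soon as `Supp(𝔮_L)` is the set of primes of `L` over `Supp(𝔮_{L_tpd})` (§4.4 «the inverse image», p.40 l.35–40;
the first half of T-26's `IsBaseChangeOf`) — the tree's [GenEll] Prop. 1.7 (i) engine `ndeg_different_add_reduced_mono`. PROVED.
[cite: MochizukiGenEll2010, Prop 1.7 (i) p.9] -/
theorem ofGenuine_diffCondMono (hV : ∀ w : HeightOneSpectrum (𝓞 L), w ∈ 𝔮L.V ↔ finBelow Ltpd L w ∈ 𝔮tpd.V) :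
    (ofGenuine Lmod hℓ h5 𝔮tpd 𝔮L 𝔮L' hq).DiffCondMono := by
  unfold DiffCondMono
  exact ndeg_different_add_reduced_mono Ltpd L 𝔮tpd.V 𝔮L.V hV

/-- **The second inequality of Theorem 6.1.1 PROVED for the genuine datum** (p.58 l.11–23). [claim: Joshi2024ATS4, status: disputed] -/
theorem ofGenuine_boundLtpd_le_boundL (hV : ∀ w : HeightOneSpectrum (𝓞 L), w ∈ 𝔮L.V ↔ finBelow Ltpd L w ∈ 𝔮tpd.V) :
    (ofGenuine Lmod hℓ h5 𝔮tpd 𝔮L 𝔮L' hq).boundLtpd ≤ (ofGenuine Lmod hℓ h5 𝔮tpd 𝔮L 𝔮L' hq).boundL :=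
  (boundLtpd_le_boundL_iff _).2 (ofGenuine_diffCondMono Lmod hℓ h5 𝔮tpd 𝔮L 𝔮L' hq hV)

/-- **On genuine data, Theorem 6.1.1 is equivalent to its FIRST inequality** `(1/6)·log(q) ≤ (1 + 20·d_mod/ℓ)·(log(d^{L_tpd}) +
log(f^{L_tpd})) + 20·(e*_mod·ℓ + 60)` — the [IUTchIV] Thm. 1.10 display at `η_prm = 60` (T-30's `thm611_left_iff_display`),
i.e. the part that rests on [IUTchIII] Cor. 3.12 / [J-III] Cor. 9.11.1.1 (Rmk. 6.1.2). [claim: Joshi2024ATS4, status: disputed] -/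
theorem ofGenuine_thm611_iff (hV : ∀ w : HeightOneSpectrum (𝓞 L), w ∈ 𝔮L.V ↔ finBelow Ltpd L w ∈ 𝔮tpd.V) :
    (ofGenuine Lmod hℓ h5 𝔮tpd 𝔮L 𝔮L' hq).Thm611 ↔
      1 / 6 * 𝔮L.logq ≤ (ofGenuine Lmod hℓ h5 𝔮tpd 𝔮L 𝔮L' hq).boundLtpd :=
  ⟨fun h => h.1, fun h => ⟨h, ofGenuine_boundLtpd_le_boundL Lmod hℓ h5 𝔮tpd 𝔮L 𝔮L' hq hV⟩⟩

/-! ### 2b. Lemma 6.4.1 for `L/L_tpd` -/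

/-- **Lemma 6.4.1 with Mochizuki's constant**: for `L/L_tpd` Galois with `[L : L_tpd] ∣ 2¹⁰·3²·5` (p.59 l.31 «[L : L_tpd] ≤
2·(2⁴·3)·(2⁵·3·5)», Lem. 4.1.2 / Lem. 6.3.2), `Supp(𝔮_L)` the inverse image of `Supp(𝔮_{L_tpd})`, `L/L_tpd` unramified at
the primes of residue characteristic `∉ {2,3,5}` off `Supp(𝔮)` and tamely ramified at those on `Supp(𝔮)` (the engine's reading
of Lem. 4.1.4 (1) / «S^ℚ_wild = {2,3,5}», p.59 l.28–34):
`log(d^L) + log(f^L) ≤ log(d^{L_tpd}) + log(f^{L_tpd}) + log(2¹¹·3³·5²)` — the tree's [IUTchIV] Step (ii) second display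
for real number fields. [claim: Mochizuki2012, status: disputed] -/
theorem ofGenuine_sharp641 [IsGalois Ltpd L] (hV : ∀ w : HeightOneSpectrum (𝓞 L), w ∈ 𝔮L.V ↔ finBelow Ltpd L w ∈ 𝔮tpd.V)
    (hdvd : Module.finrank Ltpd L ∣ 2 ^ 10 * 3 ^ 2 * 5)
    (hunr : ∀ w : HeightOneSpectrum (𝓞 L), residueChar L w ∉ ({2, 3, 5} : Finset ℕ) → finBelow Ltpd L w ∉ 𝔮tpd.V →
      w.asIdeal.ramificationIdx (𝓞 Ltpd) = 1)
    (htame : ∀ w : HeightOneSpectrum (𝓞 L), residueChar L w ∉ ({2, 3, 5} : Finset ℕ) → finBelow Ltpd L w ∈ 𝔮tpd.V →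
      ¬ residueChar L w ∣ w.asIdeal.ramificationIdx (𝓞 Ltpd)) :
    logDifferent L + 𝔮L.logf ≤ logDifferent Ltpd + 𝔮tpd.logf + Real.log (2 ^ 11 * 3 ^ 3 * 5 ^ 2) :=
  ndeg_different_add_reduced_le_F Ltpd L 𝔮tpd.V 𝔮L.V hV hdvd hunr htame

/-- **Lemma 6.4.1 PROVED for the genuine datum** («log(d^L) + log(f^L) ≤ log(d^{L_tpd}) + log(f^{L_tpd}) + 33», p.59 l.25–27),
under the hypotheses of `ofGenuine_sharp641` (`21 ≤ 33`). [claim: Joshi2024ATS4, status: disputed] -/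
theorem ofGenuine_lem641 [IsGalois Ltpd L] (hV : ∀ w : HeightOneSpectrum (𝓞 L), w ∈ 𝔮L.V ↔ finBelow Ltpd L w ∈ 𝔮tpd.V)
    (hdvd : Module.finrank Ltpd L ∣ 2 ^ 10 * 3 ^ 2 * 5)
    (hunr : ∀ w : HeightOneSpectrum (𝓞 L), residueChar L w ∉ ({2, 3, 5} : Finset ℕ) → finBelow Ltpd L w ∉ 𝔮tpd.V →
      w.asIdeal.ramificationIdx (𝓞 Ltpd) = 1)
    (htame : ∀ w : HeightOneSpectrum (𝓞 L), residueChar L w ∉ ({2, 3, 5} : Finset ℕ) → finBelow Ltpd L w ∈ 𝔮tpd.V →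
      ¬ residueChar L w ∣ w.asIdeal.ramificationIdx (𝓞 Ltpd)) :
    (ofGenuine Lmod hℓ h5 𝔮tpd 𝔮L 𝔮L' hq).Lem641 :=
  lem641_of_sharp _ (ofGenuine_sharp641 𝔮tpd 𝔮L hV hdvd hunr htame)

/-- **`[L : L_tpd] ≤ 2¹⁰·3²·5`** (T-30's `DegLLtpdBound`, p.59 l.31) for the genuine datum, from the divisibility.
[claim: Joshi2024ATS4, status: disputed] -/
theorem ofGenuine_degLLtpdBound (hdvd : Module.finrank Ltpd L ∣ 2 ^ 10 * 3 ^ 2 * 5) :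
    (ofGenuine Lmod hℓ h5 𝔮tpd 𝔮L 𝔮L' hq).DegLLtpdBound :=
  Nat.le_of_dvd (by norm_num) hdvd

/-! ### 2c. Lemma 6.4.2 for `L′/L/L_tpd` -/

include hℓ h5 in
/-- **The wild term at `ℓ` with Mochizuki's constant**: for `L′/L` Galois with `[L′ : L] ∣ ℓ·(ℓ−1)²·(ℓ+1)` (`Gal(L′/L) ↪
GL₂(𝔽_ℓ)`, `|GL₂(𝔽_ℓ)| = ℓ(ℓ+1)(ℓ−1)²`, Lem. 6.3.2; p.60 l.26–27), `Supp(𝔮_{L′})` the inverse image of `Supp(𝔮_L)`, `L′/L`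
unramified at residue characteristic `≠ ℓ` off `Supp(𝔮)` and tame at residue characteristic `≠ ℓ` on `Supp(𝔮)` (the engine's
reading of Lem. 4.1.4 (2) / «S^ℚ_wild = {ℓ}», p.60 l.22–28):
`log(d^{L′}) + log(f^{L′}) ≤ log(d^L) + log(f^L) + 2·log ℓ` — the tree's [IUTchIV] Step (ii) third display.
[claim: Mochizuki2012, status: disputed] -/
theorem ofGenuine_sharp642 [IsGalois L L'] (hV' : ∀ u : HeightOneSpectrum (𝓞 L'), u ∈ 𝔮L'.V ↔ finBelow L L' u ∈ 𝔮L.V)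
    (hdvd' : Module.finrank L L' ∣ ℓ * (ℓ - 1) ^ 2 * (ℓ + 1))
    (hunr' : ∀ u : HeightOneSpectrum (𝓞 L'), residueChar L' u ≠ ℓ → finBelow L L' u ∉ 𝔮L.V →
      u.asIdeal.ramificationIdx (𝓞 L) = 1)
    (htame' : ∀ u : HeightOneSpectrum (𝓞 L'), residueChar L' u ≠ ℓ → finBelow L L' u ∈ 𝔮L.V →
      ¬ residueChar L' u ∣ u.asIdeal.ramificationIdx (𝓞 L)) :
    logDifferent L' + 𝔮L'.logf ≤ logDifferent L + 𝔮L.logf + 2 * Real.log ℓ :=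
  ndeg_different_add_reduced_le_K' L L' hℓ h5 𝔮L.V 𝔮L'.V hV' hdvd' hunr' htame'

/-- **`[L′ : L] ≤ ℓ⁴`** (T-30's `DegLpLBound`, p.60 l.26–27 «by Lemma 6.3.2») for the genuine datum, from
`[L′ : L] ∣ ℓ(ℓ−1)²(ℓ+1) ≤ ℓ⁴`. [claim: Joshi2024ATS4, status: disputed] -/
theorem ofGenuine_degLpLBound (hdvd' : Module.finrank L L' ∣ ℓ * (ℓ - 1) ^ 2 * (ℓ + 1)) :
    (ofGenuine Lmod hℓ h5 𝔮tpd 𝔮L 𝔮L' hq).DegLpLBound := by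
  unfold DegLpLBound
  have hne : ℓ * (ℓ - 1) ^ 2 * (ℓ + 1) ≠ 0 :=
    Nat.mul_ne_zero (Nat.mul_ne_zero hℓ.ne_zero (pow_ne_zero 2 (by have := hℓ.two_le; omega))) (Nat.succ_ne_zero ℓ)
  refine (Nat.le_of_dvd (Nat.pos_of_ne_zero hne) hdvd').trans ?_
  rw [mul_right_comm]
  exact card_GL_two_formula_le_pow_four ℓ

/-- **Lemma 6.4.2 (1) PROVED for the genuine datum** («log(d^{L′}) ≤ log(d^{L′}) + log(f^{L′}) ≤ log(d^{L_tpd}) + log(f^{L_tpd})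
+ 4·log(ℓ) + 33», p.59 l.37–p.60 l.5), under the hypotheses of `ofGenuine_sharp641` and `ofGenuine_sharp642` (in fact with
`2·log ℓ + 21`). [claim: Joshi2024ATS4, status: disputed] -/
theorem ofGenuine_lem642a [IsGalois Ltpd L] [IsGalois L L']
    (hV : ∀ w : HeightOneSpectrum (𝓞 L), w ∈ 𝔮L.V ↔ finBelow Ltpd L w ∈ 𝔮tpd.V)
    (hdvd : Module.finrank Ltpd L ∣ 2 ^ 10 * 3 ^ 2 * 5)
    (hunr : ∀ w : HeightOneSpectrum (𝓞 L), residueChar L w ∉ ({2, 3, 5} : Finset ℕ) → finBelow Ltpd L w ∉ 𝔮tpd.V →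
      w.asIdeal.ramificationIdx (𝓞 Ltpd) = 1)
    (htame : ∀ w : HeightOneSpectrum (𝓞 L), residueChar L w ∉ ({2, 3, 5} : Finset ℕ) → finBelow Ltpd L w ∈ 𝔮tpd.V →
      ¬ residueChar L w ∣ w.asIdeal.ramificationIdx (𝓞 Ltpd))
    (hV' : ∀ u : HeightOneSpectrum (𝓞 L'), u ∈ 𝔮L'.V ↔ finBelow L L' u ∈ 𝔮L.V)
    (hdvd' : Module.finrank L L' ∣ ℓ * (ℓ - 1) ^ 2 * (ℓ + 1))
    (hunr' : ∀ u : HeightOneSpectrum (𝓞 L'), residueChar L' u ≠ ℓ → finBelow L L' u ∉ 𝔮L.V →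
      u.asIdeal.ramificationIdx (𝓞 L) = 1)
    (htame' : ∀ u : HeightOneSpectrum (𝓞 L'), residueChar L' u ≠ ℓ → finBelow L L' u ∈ 𝔮L.V →
      ¬ residueChar L' u ∣ u.asIdeal.ramificationIdx (𝓞 L)) :
    (ofGenuine Lmod hℓ h5 𝔮tpd 𝔮L 𝔮L' hq).Lem642a :=
  lem642a_of_sharp _ (ofGenuine_lem641 Lmod hℓ h5 𝔮tpd 𝔮L 𝔮L' hq hV hdvd hunr htame)
    (ofGenuine_sharp642 hℓ h5 𝔮L 𝔮L' hV' hdvd' hunr' htame')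

/-- **Lemma 6.4.2 (2) PROVED for the genuine datum** («(1 + 4/ℓ)·log(d^{L′}) ≤ (1 + 4/ℓ)·(log(d^{L_tpd}) + log(f^{L_tpd})) +
4·log(ℓ) + 74», p.60 l.6–21), by T-30's `lem642b_of_lem642a` (the printed real arithmetic). [claim: Joshi2024ATS4, status: disputed] -/
theorem ofGenuine_lem642b [IsGalois Ltpd L] [IsGalois L L']
    (hV : ∀ w : HeightOneSpectrum (𝓞 L), w ∈ 𝔮L.V ↔ finBelow Ltpd L w ∈ 𝔮tpd.V)
    (hdvd : Module.finrank Ltpd L ∣ 2 ^ 10 * 3 ^ 2 * 5)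
    (hunr : ∀ w : HeightOneSpectrum (𝓞 L), residueChar L w ∉ ({2, 3, 5} : Finset ℕ) → finBelow Ltpd L w ∉ 𝔮tpd.V →
      w.asIdeal.ramificationIdx (𝓞 Ltpd) = 1)
    (htame : ∀ w : HeightOneSpectrum (𝓞 L), residueChar L w ∉ ({2, 3, 5} : Finset ℕ) → finBelow Ltpd L w ∈ 𝔮tpd.V →
      ¬ residueChar L w ∣ w.asIdeal.ramificationIdx (𝓞 Ltpd))
    (hV' : ∀ u : HeightOneSpectrum (𝓞 L'), u ∈ 𝔮L'.V ↔ finBelow L L' u ∈ 𝔮L.V)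
    (hdvd' : Module.finrank L L' ∣ ℓ * (ℓ - 1) ^ 2 * (ℓ + 1))
    (hunr' : ∀ u : HeightOneSpectrum (𝓞 L'), residueChar L' u ≠ ℓ → finBelow L L' u ∉ 𝔮L.V →
      u.asIdeal.ramificationIdx (𝓞 L) = 1)
    (htame' : ∀ u : HeightOneSpectrum (𝓞 L'), residueChar L' u ≠ ℓ → finBelow L L' u ∈ 𝔮L.V →
      ¬ residueChar L' u ∣ u.asIdeal.ramificationIdx (𝓞 L)) :
    (ofGenuine Lmod hℓ h5 𝔮tpd 𝔮L 𝔮L' hq).Lem642b :=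
  lem642b_of_lem642a _ (ofGenuine_lem642a Lmod hℓ h5 𝔮tpd 𝔮L 𝔮L' hq hV hdvd hunr htame hV' hdvd' hunr' htame')

/-- **Lemma 6.4.2 (1) for the genuine datum DIRECTLY FROM THE PRINTED RAMIFICATION HYPOTHESES of Lemma 4.1.4** (p.38
l.32–39), read from `L_tpd` to `L′` in one step by the tree's three-field engine `ndeg_different_add_reduced_le_theta` (so that
tame ramification of `L/L_tpd` over `ℓ` off `Supp(𝔮)`, which Lem. 4.1.4 (1) allows, is covered): `L/L_tpd` and `L′/L` Galois,
`[L : L_tpd] ∣ 2¹⁰·3²·5`, `[L′ : L] ∣ ℓ(ℓ−1)²(ℓ+1)`, `ℓ ≥ 7`; `L/L_tpd` unramified at residue characteristic `∉ {2,3,5,ℓ}` off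
`Supp(𝔮_{L_tpd})` and tame at residue characteristic `∉ {2,3,5}` (Lem. 4.1.4 (1) verbatim); `L′/L` unramified at residue
characteristic `∉ {2,3,5,ℓ}` off `Supp(𝔮_{L_tpd})`, tame there on it, and tame above `2,3,5` (Lem. 4.1.4 (2) gives all of this
except «tame above 2» — LOCATED, not adjudicated). Constant: `log(2¹¹·3³·5²) + 2·log ℓ ≤ 4·log ℓ + 33`. Lemma 6.4.1 is not
passed through. [claim: Joshi2024ATS4, status: disputed] -/
theorem ofGenuine_lem642a_of_lem414Reading [Algebra Ltpd L'] [IsScalarTower Ltpd L L'] [IsGalois Ltpd L] [IsGalois L L']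
    (h7 : 7 ≤ ℓ) (hT : ∀ u : HeightOneSpectrum (𝓞 L'), u ∈ 𝔮L'.V ↔ finBelow Ltpd L' u ∈ 𝔮tpd.V)
    (hdvd : Module.finrank Ltpd L ∣ 2 ^ 10 * 3 ^ 2 * 5) (hdvd' : Module.finrank L L' ∣ ℓ * (ℓ - 1) ^ 2 * (ℓ + 1))
    (hKunr : ∀ u : HeightOneSpectrum (𝓞 L'), residueChar L' u ∉ ({2, 3, 5, ℓ} : Finset ℕ) →
      finBelow Ltpd L' u ∉ 𝔮tpd.V → u.asIdeal.ramificationIdx (𝓞 L) = 1)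
    (hKtame : ∀ u : HeightOneSpectrum (𝓞 L'), residueChar L' u ∉ ({2, 3, 5, ℓ} : Finset ℕ) →
      finBelow Ltpd L' u ∈ 𝔮tpd.V → ¬ residueChar L' u ∣ u.asIdeal.ramificationIdx (𝓞 L))
    (hKtop : ∀ u : HeightOneSpectrum (𝓞 L'), residueChar L' u ∈ ({2, 3, 5} : Finset ℕ) →
      ¬ residueChar L' u ∣ u.asIdeal.ramificationIdx (𝓞 L))
    (hFunr : ∀ w : HeightOneSpectrum (𝓞 L), residueChar L w ∉ ({2, 3, 5, ℓ} : Finset ℕ) →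
      finBelow Ltpd L w ∉ 𝔮tpd.V → w.asIdeal.ramificationIdx (𝓞 Ltpd) = 1)
    (hFtame : ∀ w : HeightOneSpectrum (𝓞 L), residueChar L w ∉ ({2, 3, 5} : Finset ℕ) →
      ¬ residueChar L w ∣ w.asIdeal.ramificationIdx (𝓞 Ltpd)) :
    (ofGenuine Lmod hℓ h5 𝔮tpd 𝔮L 𝔮L' hq).Lem642a := by
  have key := ndeg_different_add_reduced_le_theta Ltpd L L' hℓ h7 𝔮tpd.V 𝔮L'.V hT hdvd hdvd' hKunr hKtame hKtop hFunr
    hFtame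
  have h21 := log_two_pow_eleven_mul_le
  have hlog : 0 ≤ Real.log (ℓ : ℝ) := Real.log_nonneg (by exact_mod_cast hℓ.one_lt.le)
  unfold Lem642a
  refine ⟨by show logDifferent L' ≤ logDifferent L' + 𝔮L'.logf; linarith [𝔮L'.logf_nonneg], ?_⟩
  show logDifferent L' + 𝔮L'.logf ≤ logDifferent Ltpd + 𝔮tpd.logf + 4 * Real.log (ℓ : ℝ) + 33
  have key' : logDifferent L' + 𝔮L'.logf ≤ logDifferent Ltpd + 𝔮tpd.logf +
      (Real.log (2 ^ 11 * 3 ^ 3 * 5 ^ 2) + 2 * Real.log ℓ) := key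
  linarith

/-- **Summary — §6.4 and the second half of Thm. 6.1.1 DISCHARGED on genuine Galois towers**: under the hypotheses above the
genuine datum satisfies `Lem641 ∧ Lem642a ∧ Lem642b ∧ DiffCondMono ∧ DegLLtpdBound ∧ DegLpLBound`; what remains of Thm. 6.1.1
there is exactly its first inequality (`ofGenuine_thm611_iff`). [claim: Joshi2024ATS4, status: disputed] -/
theorem ofGenuine_section64 [IsGalois Ltpd L] [IsGalois L L']
    (hV : ∀ w : HeightOneSpectrum (𝓞 L), w ∈ 𝔮L.V ↔ finBelow Ltpd L w ∈ 𝔮tpd.V)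
    (hdvd : Module.finrank Ltpd L ∣ 2 ^ 10 * 3 ^ 2 * 5)
    (hunr : ∀ w : HeightOneSpectrum (𝓞 L), residueChar L w ∉ ({2, 3, 5} : Finset ℕ) → finBelow Ltpd L w ∉ 𝔮tpd.V →
      w.asIdeal.ramificationIdx (𝓞 Ltpd) = 1)
    (htame : ∀ w : HeightOneSpectrum (𝓞 L), residueChar L w ∉ ({2, 3, 5} : Finset ℕ) → finBelow Ltpd L w ∈ 𝔮tpd.V →
      ¬ residueChar L w ∣ w.asIdeal.ramificationIdx (𝓞 Ltpd))
    (hV' : ∀ u : HeightOneSpectrum (𝓞 L'), u ∈ 𝔮L'.V ↔ finBelow L L' u ∈ 𝔮L.V)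
    (hdvd' : Module.finrank L L' ∣ ℓ * (ℓ - 1) ^ 2 * (ℓ + 1))
    (hunr' : ∀ u : HeightOneSpectrum (𝓞 L'), residueChar L' u ≠ ℓ → finBelow L L' u ∉ 𝔮L.V →
      u.asIdeal.ramificationIdx (𝓞 L) = 1)
    (htame' : ∀ u : HeightOneSpectrum (𝓞 L'), residueChar L' u ≠ ℓ → finBelow L L' u ∈ 𝔮L.V →
      ¬ residueChar L' u ∣ u.asIdeal.ramificationIdx (𝓞 L)) :
    (ofGenuine Lmod hℓ h5 𝔮tpd 𝔮L 𝔮L' hq).Lem641 ∧ (ofGenuine Lmod hℓ h5 𝔮tpd 𝔮L 𝔮L' hq).Lem642a ∧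
      (ofGenuine Lmod hℓ h5 𝔮tpd 𝔮L 𝔮L' hq).Lem642b ∧ (ofGenuine Lmod hℓ h5 𝔮tpd 𝔮L 𝔮L' hq).DiffCondMono ∧
      (ofGenuine Lmod hℓ h5 𝔮tpd 𝔮L 𝔮L' hq).DegLLtpdBound ∧ (ofGenuine Lmod hℓ h5 𝔮tpd 𝔮L 𝔮L' hq).DegLpLBound :=
  ⟨ofGenuine_lem641 Lmod hℓ h5 𝔮tpd 𝔮L 𝔮L' hq hV hdvd hunr htame,
    ofGenuine_lem642a Lmod hℓ h5 𝔮tpd 𝔮L 𝔮L' hq hV hdvd hunr htame hV' hdvd' hunr' htame',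
    ofGenuine_lem642b Lmod hℓ h5 𝔮tpd 𝔮L 𝔮L' hq hV hdvd hunr htame hV' hdvd' hunr' htame',
    ofGenuine_diffCondMono Lmod hℓ h5 𝔮tpd 𝔮L 𝔮L' hq hV,
    ofGenuine_degLLtpdBound Lmod hℓ h5 𝔮tpd 𝔮L 𝔮L' hq hdvd,
    ofGenuine_degLpLBound Lmod hℓ h5 𝔮tpd 𝔮L 𝔮L' hq hdvd'⟩

end Genuine

/-! ## 3. Junction with the E5 descent spine: the §6.4 inputs replaced by Lemma 6.4.2 (2) -/
section Spine
variable {M : MainBoundDatum} {d : LocusVolumeDatum} (G : MainBoundGlue M d)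
include G

/-- **E-t31's «E5 DESCENT SPINE END TO END» with its §6.4 inputs collapsed**: `MainBoundGlue.thm611_left_of_inputs` reads
`Lem641`, `WildBoundLp` (Joshi's Thm. 4.6.1 (5) for `L′/L`, not kernel-derived) and `DegLpLBound` only to obtain Lemma 6.4.2 (2);
here that lemma is the hypothesis (E-t31's `d.Lem642₂` under the glue), everything else verbatim BY NAME. Composition only.
[claim: Joshi2024ATS4, status: disputed] -/
theorem thm611_left_of_lem642b (h7 : 7 ≤ M.ell) (h642b : M.Lem642b)
    (h₁ : d.Eq6111) (h₂ : ∀ p ∈ d.Vdst, d.Prop6109 p) (h₃ : d.ComponentSums) (h₅ : d.Eq6811) (h₆ : d.Lem678)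
    (h₇ : d.LowerBound) (h₈ : d.FrobShiftQ) (h₉ : d.FrobShiftVol) (hD : d.LogqDictionary) :
    1 / 6 * M.logq ≤ M.boundLtpd :=
  G.thm611_left_of_thm6101 h7 hD (d.thm6101_of_inputs h₁ h₂ h₃ (G.lem642_iff.2 h642b) h₅ h₆ h₇ h₈ h₉ hD)

end Spine

section SpineGenuine

variable {Lmod : Type*} [Field Lmod] [NumberField Lmod]
variable {Ltpd L L' : Type*} [Field Ltpd] [NumberField Ltpd] [Field L] [NumberField L] [Field L'] [NumberField L']
  [Algebra Ltpd L] [Algebra L L']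
variable {ℓ : ℕ} {hℓ : ℓ.Prime} {h5 : 5 ≤ ℓ}
variable {𝔮tpd : TateDivisorDatum Ltpd} {𝔮L : TateDivisorDatum L} {𝔮L' : TateDivisorDatum L'} {hq : 0 < 𝔮L.logq}
variable {d : LocusVolumeDatum} (G : MainBoundGlue (ofGenuine Lmod hℓ h5 𝔮tpd 𝔮L 𝔮L' hq) d)
include G

/-- **On a genuine Galois tower the spine needs NO §6.4 input**: E-t31's §6.8–§6.11 inputs + the glue + `ℓ ≥ 7` + the ramification
and degree hypotheses of `ofGenuine_lem642b` ⟹ the first inequality of Thm. 6.1.1, `(1/6)·log(𝔮_L) ≤ (1 + 20·d_mod/ℓ)·(log(d^{L_tpd})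
+ log(𝔣_{L_tpd})) + 20·(e*_mod·ℓ + 60)`; with `ofGenuine_thm611_iff`, the whole of Thm. 6.1.1 there. Composition only — the
[J-III] lower bound (`d.LowerBound`, Cor. 9.11.1.1 at `φ(y₀)`) and the §6.8–§6.11 identities stay HYPOTHESES BY NAME.
[claim: Joshi2024ATS4, status: disputed] -/
theorem ofGenuine_thm611_left_of_descent [IsGalois Ltpd L] [IsGalois L L'] (h7 : 7 ≤ ℓ)
    (hV : ∀ w : HeightOneSpectrum (𝓞 L), w ∈ 𝔮L.V ↔ finBelow Ltpd L w ∈ 𝔮tpd.V)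
    (hdvd : Module.finrank Ltpd L ∣ 2 ^ 10 * 3 ^ 2 * 5)
    (hunr : ∀ w : HeightOneSpectrum (𝓞 L), residueChar L w ∉ ({2, 3, 5} : Finset ℕ) → finBelow Ltpd L w ∉ 𝔮tpd.V →
      w.asIdeal.ramificationIdx (𝓞 Ltpd) = 1)
    (htame : ∀ w : HeightOneSpectrum (𝓞 L), residueChar L w ∉ ({2, 3, 5} : Finset ℕ) → finBelow Ltpd L w ∈ 𝔮tpd.V →
      ¬ residueChar L w ∣ w.asIdeal.ramificationIdx (𝓞 Ltpd))
    (hV' : ∀ u : HeightOneSpectrum (𝓞 L'), u ∈ 𝔮L'.V ↔ finBelow L L' u ∈ 𝔮L.V)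
    (hdvd' : Module.finrank L L' ∣ ℓ * (ℓ - 1) ^ 2 * (ℓ + 1))
    (hunr' : ∀ u : HeightOneSpectrum (𝓞 L'), residueChar L' u ≠ ℓ → finBelow L L' u ∉ 𝔮L.V →
      u.asIdeal.ramificationIdx (𝓞 L) = 1)
    (htame' : ∀ u : HeightOneSpectrum (𝓞 L'), residueChar L' u ≠ ℓ → finBelow L L' u ∈ 𝔮L.V →
      ¬ residueChar L' u ∣ u.asIdeal.ramificationIdx (𝓞 L))
    (h₁ : d.Eq6111) (h₂ : ∀ p ∈ d.Vdst, d.Prop6109 p) (h₃ : d.ComponentSums) (h₅ : d.Eq6811) (h₆ : d.Lem678)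
    (h₇ : d.LowerBound) (h₈ : d.FrobShiftQ) (h₉ : d.FrobShiftVol) (hD : d.LogqDictionary) :
    1 / 6 * 𝔮L.logq ≤ (ofGenuine Lmod hℓ h5 𝔮tpd 𝔮L 𝔮L' hq).boundLtpd :=
  thm611_left_of_lem642b G h7
    (ofGenuine_lem642b Lmod hℓ h5 𝔮tpd 𝔮L 𝔮L' hq hV hdvd hunr htame hV' hdvd' hunr' htame') h₁ h₂ h₃ h₅ h₆ h₇ h₈ h₉ hD

end SpineGenuine

end MainBoundDatum

end Summit.ABC.IUTFork.Joshi.ATS4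

end
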